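import Literature.Probability.LatticeModels.IsingDisorderObservable
import Literature.Probability.LatticeModels.SlitPlaneSpinor
import HarnessLib

/-!
# The explicit full-plane spinor in the tree's corner frame: `F_{[ℂ_δ,a]}` as an s-holomorphic
# bond function with branch cut `L_a`

Topic `Literature/Probability/LatticeModels`. Chelkak–Hongler–Izyurov (Ann. of Math. 181 (2015)),
Lemma 2.14 / §3.2: the full-plane spinor `F_{[ℂ_δ,a]}` is s-holomorphic on the double cover of
`ℂ_δ ∖ {a + δ/2}` branched at `a`, with `F(a + 3δ/2) = 1` and (Lemma 3.5)
`P_{iℝ} F(a + (1 ± i)δ/2) = ∓ i`. `SlitPlaneSpinor.lean` realises its two sheets `slitFup`,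
`slitFdn` explicitly in the coordinates `(k, s)` of the lattice `V¹ ∪ V^i` of `1`- and `i`-type
corners (tip `(0, 0)`, source `(-1, 0)`, cut `L_a = {s = 0, k ≤ -1}`), with the discrete
Cauchy–Riemann identities `slitFup_cr` (`s ≥ 0`), `slitFdn_cr` (`s ≤ -1`).

This file transplants it into the tree's own language — bond functions `MedialVertex → ℂ` and the
predicate `IsSHolAt` of `SHolomorphicPrimitive.lean` (coded corners `(y, k)`, corner lines of
frame index `k`, the vectors `kcVec 0 0 a d` of `IsingDisorderFermion.lean` with frame projections
`a, (a+d)·, d·, (a-d)·`) — around a source plaquette `p₀` (lower-left site), exactly as the signed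
Kadanoff–Ceva observable `kcObs` of `IsingDisorderObservable.lean` is packaged:

* the dictionary (`srcDX`, `srcDY`): CHI's lattice is the tree's rotated by `45°`; the site `y`
  has CHI coordinates `x = Δy₀ + Δy₁`, `y = Δy₁ - Δy₀` relative to `p₀`, the `1`-type corner
  `(y, NE)` sits at the model point `(k, s) = (-x, y)` and the `i`-type corner `(y, SW)` at
  `(1 - x, y)` (the tree realises the mirror image of CHI's picture: the tip is the corner
  `(p₀, NE)`, the source the corner `(p₀ + e₀ + e₁, SW)`, one unit east of it);
* **`slitFC p₀ : MedialVertex → ℂ`** (`slitFCH` on east bonds, `slitFCV` on north bonds): the bond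
  at model height `σ ± ½` carries `kcVec 0 0 a d` with `a = Re F(1-corner)`, `d = Re(-i F(i-corner))`,
  `F` the sheet of the bond's side of the cut row (`slitFsh`);
* **s-holomorphicity** (`isSHolAt_slitFC_zero`, `_one`, `_three` at every site, `_two` off the
  cut): at the `1`/`i`-type corners the two bonds use the same corner value (on the cut row the two
  sheets agree at `1`-type corners and at the `i`-type corners east of the source), and at the
  `λ`-type corners `(y, NW)`, `(y, SE)` the frame relations `a₁ + d₁ = a₂ + d₂`, `a₁ - d₁ = a₂ - d₂`
  are the real parts of `slitFup_cr` / `slitFdn_cr` (`cr_re_parts`);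
* **the cut** (`projLine_slitFC_two_cut`): at the `i`-type corners `(y, SW)` on the cut row west of
  the tip (model `(k, 0)`, `k ≤ -1` odd — the source included) the two projections are opposite:
  the sheet change of the spinor across `L_a`, the tree's form of "`F_{[ℂ_δ,a]}` is not
  s-holomorphic at `a + δ/2`" and of the branching.

Everything is proved; no named fact. NOT here: the comparison with `kcObs` at the source
(Lemma 3.5 proper, which needs the Kadanoff–Ceva values in the same gauge) and the asymptotics
(`SlitPlaneAsymptotics.lean`).

## References

* D. Chelkak, C. Hongler, K. Izyurov, Ann. of Math. 181 (2015) = arXiv:1202.2838: Lemma 2.14,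
  Remark 3.1, Lemma 3.5, §3.2 [ChelkakHonglerIzyurovAnnals2015].
-/

noncomputable section

open Complex

namespace Literature.Probability.LatticeModels

/-! ### Real parts of a discrete Cauchy–Riemann identity -/

/-- **The two frame relations contained in one CR identity**: if
`i (z₁₁ - z₀₀) = z₀₁ - z₁₀` then `Re z₀₀ + Re(-i z₀₁) = Re z₁₁ + Re(-i z₁₀)` and
`Re z₁₀ - Re(-i z₁₁) = Re z₀₁ - Re(-i z₀₀)`. [folklore] -/
theorem cr_re_parts {z₀₀ z₁₁ z₀₁ z₁₀ : ℂ} (h : I * (z₁₁ - z₀₀) = z₀₁ - z₁₀) :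
    (z₀₀.re + (-I * z₀₁).re = z₁₁.re + (-I * z₁₀).re) ∧ (z₁₀.re - (-I * z₁₁).re = z₀₁.re - (-I * z₀₀).re) := by
  have hre := congrArg Complex.re h
  have him := congrArg Complex.im h
  simp only [Complex.mul_re, Complex.mul_im, Complex.I_re, Complex.I_im, Complex.sub_re, Complex.sub_im, zero_mul,
    one_mul, zero_sub, zero_add] at hre him
  have e1 : ∀ z : ℂ, (-I * z).re = z.im := fun z => by simp
  simp only [e1]
  constructor <;> linarith

/-! ### The dictionary: CHI coordinates of a site relative to the source plaquette -/

/-- CHI's abscissa of the site `y` relative to `p₀`: `x = Δy₀ + Δy₁`. [folklore] -/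
def srcDX (p₀ y : Site 2) : ℤ := (y 0 - p₀ 0) + (y 1 - p₀ 1)

/-- CHI's ordinate of the site `y` relative to `p₀`: `y = Δy₁ - Δy₀`. [folklore] -/
def srcDY (p₀ y : Site 2) : ℤ := (y 1 - p₀ 1) - (y 0 - p₀ 0)

/-- The sheet used by a bond: `slitFup` above the cut row (`0 ≤ σ`), `slitFdn` below. [folklore] -/
def slitFsh (σ k s : ℤ) : ℂ := if 0 ≤ σ then slitFup k s else slitFdn k s

/-- **The CR identity of the sheet of a bond**: both sheets satisfy it on the cells they are used
on — `slitFup` for `s ≥ 0`, `slitFdn` for `s ≤ -1` — so `slitFsh s` does at every cell of row `s`. [folklore] -/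
theorem slitFsh_cr (k s : ℤ) :
    I * (slitFsh s (k + 1) (s + 1) - slitFsh s k s) = slitFsh s k (s + 1) - slitFsh s (k + 1) s := by
  unfold slitFsh
  split_ifs with h
  · exact slitFup_cr k h
  · exact slitFdn_cr k (by omega)

/-- Coordinates of the west neighbour `y - e₀`. [folklore] -/
theorem srcDX_west (p₀ y : Site 2) : srcDX p₀ (y + cornerUnit 2) = srcDX p₀ y - 1 ∧ srcDY p₀ (y + cornerUnit 2) = srcDY p₀ y + 1 := by
  simp [srcDX, srcDY, cornerUnit]; constructor <;> ring

/-- Coordinates of the south neighbour `y - e₁`. [folklore] -/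
theorem srcDX_south (p₀ y : Site 2) : srcDX p₀ (y + cornerUnit 3) = srcDX p₀ y - 1 ∧ srcDY p₀ (y + cornerUnit 3) = srcDY p₀ y - 1 := by
  simp [srcDX, srcDY, cornerUnit]; constructor <;> ring

/-- `x + y` is even (faces of CHI's lattice): `-x + y = -2 Δy₀`. [folklore] -/
theorem neg_srcDX_add_srcDY (p₀ y : Site 2) : -srcDX p₀ y + srcDY p₀ y = -2 * (y 0 - p₀ 0) := by
  simp [srcDX, srcDY]; ring

/-! ### The bond function -/

/-- **`F_C` on the east bond `{v, v + e₀}`** (model height `σ₀ - ½`, `σ₀ = srcDY v`): `a` = the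
`1`-corner `(v, NE)` at `(-x, σ₀)`, `d` = the `i`-corner `(v + e₀, SW)` at `(-x, σ₀ - 1)`, both on
the sheet of the bond (`σ₀ - 1 ≥ 0` above the cut row). [cite: ChelkakHonglerIzyurovAnnals2015, Lemma 2.14 and Remark 3.1] -/
def slitFCH (p₀ v : Site 2) : ℂ :=
  kcVec 0 0 (slitFsh (srcDY p₀ v - 1) (-srcDX p₀ v) (srcDY p₀ v)).re
    (-I * slitFsh (srcDY p₀ v - 1) (-srcDX p₀ v) (srcDY p₀ v - 1)).re

/-- **`F_C` on the north bond `{x, x + e₁}`** (model height `σ₀ + ½`): `a` = `(x, NE)` at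
`(-x, σ₀)`, `d` = `(x + e₁, SW)` at `(-x, σ₀ + 1)`. [cite: ChelkakHonglerIzyurovAnnals2015, Lemma 2.14 and Remark 3.1] -/
def slitFCV (p₀ x : Site 2) : ℂ :=
  kcVec 0 0 (slitFsh (srcDY p₀ x) (-srcDX p₀ x) (srcDY p₀ x)).re
    (-I * slitFsh (srcDY p₀ x) (-srcDX p₀ x) (srcDY p₀ x + 1)).re

open scoped Classical in
/-- **The explicit full-plane spinor as a bond function** around the source plaquette `p₀`
(`slitFCH` on east bonds, `slitFCV` on north bonds, junk `0` on non-bonds). [cite: ChelkakHonglerIzyurovAnnals2015, Lemma 2.14] -/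
def slitFC (p₀ : Site 2) (e : MedialVertex) : ℂ :=
  if h : ∃ v : Site 2, e = s(v, v + cornerUnit 0) then slitFCH p₀ h.choose
  else if h' : ∃ x : Site 2, e = s(x, x + cornerUnit 1) then slitFCV p₀ h'.choose else 0

/-- The bond function on an east bond. [folklore] -/
theorem slitFC_east (p₀ v : Site 2) : slitFC p₀ s(v, v + cornerUnit 0) = slitFCH p₀ v := by
  classical
  have h : ∃ u : Site 2, s(v, v + cornerUnit 0) = s(u, u + cornerUnit 0) := ⟨v, rfl⟩
  rw [slitFC, dif_pos h, eastBond_injective h.choose_spec.symm]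

/-- The bond function on a north bond. [folklore] -/
theorem slitFC_north (p₀ x : Site 2) : slitFC p₀ s(x, x + cornerUnit 1) = slitFCV p₀ x := by
  classical
  have h : ¬ ∃ u : Site 2, s(x, x + cornerUnit 1) = s(u, u + cornerUnit 0) := fun ⟨u, hu⟩ => northBond_ne_eastBond x u hu
  have h' : ∃ u : Site 2, s(x, x + cornerUnit 1) = s(u, u + cornerUnit 1) := ⟨x, rfl⟩
  rw [slitFC, dif_neg h, dif_pos h', northBond_injective h'.choose_spec.symm]

/-! ### The frame projections of `kcVec 0 0 a d` at index `0, 1, 2, 3` -/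

/-- Index `1`: `(a + d) N₀`. [folklore] -/
theorem re_frameCoord_kcVec0_one (a d : ℝ) : (frameCoord 0 (kcVec 0 0 a d) * (1 + I) ^ 1).re = (a + d) * frameNorm 0 0 := by
  simpa using re_frameCoord_kcVec_one 0 0 a d

/-- Index `2`: `2 d N₀`. [folklore] -/
theorem re_frameCoord_kcVec0_two (a d : ℝ) : (frameCoord 0 (kcVec 0 0 a d) * (1 + I) ^ 2).re = 2 * d * frameNorm 0 0 := by
  simpa using re_frameCoord_kcVec_two 0 0 a d

/-- Index `3`: `-2 (a - d) N₀`. [folklore] -/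
theorem re_frameCoord_kcVec0_three (a d : ℝ) : (frameCoord 0 (kcVec 0 0 a d) * (1 + I) ^ 3).re = -2 * (a - d) * frameNorm 0 0 := by
  simpa using re_frameCoord_kcVec_three 0 0 a d

/-! ### s-holomorphicity -/

/-- **`IsSHolAt` at the `1`-type corner `(y, NE)`**, at every site: the east and the north bond of
`y` both carry `a = Re F(-x, σ₀)`; on the cut row (`σ₀ = 0`) the two sheets agree there because
`-x + σ₀` is even (`slitFup_eq_slitFdn`). [cite: ChelkakHonglerIzyurovAnnals2015, Lemma 2.14] -/
theorem isSHolAt_slitFC_zero (p₀ y : Site 2) : IsSHolAt (slitFC p₀) (y, 0) := by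
  show projLine (cornerLine y (cFace (y, 0))) (slitFC p₀ (cSrc (y, 0))) = projLine (cornerLine y (cFace (y, 0))) (slitFC p₀ (cTgt (y, 0)))
  simp only [cFace, cSrc, cTgt, show (0 : Fin 4) + 1 = 1 from rfl, slitFC_east, slitFC_north]
  rw [projLine_cornerLine_eq_iff 0 y 0 (n := 0) (by norm_num), slitFCH, slitFCV, re_frameCoord_kcVec_zero, re_frameCoord_kcVec_zero]
  congr 1
  -- the `a`-values: same point `(-x, σ₀)`, sheets `σ₀ - 1` and `σ₀`
  unfold slitFsh
  by_cases h1 : 0 ≤ srcDY p₀ y - 1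
  · rw [if_pos h1, if_pos (by omega)]
  · rw [if_neg h1]
    by_cases h0 : 0 ≤ srcDY p₀ y
    · rw [if_pos h0]
      have hs : srcDY p₀ y = 0 := by omega
      have heven : Even (-srcDX p₀ y) := by
        have := neg_srcDX_add_srcDY p₀ y
        rw [hs, add_zero] at this
        exact ⟨-(y 0 - p₀ 0), by omega⟩
      rw [slitFup_eq_slitFdn (Or.inr (Or.inl heven))]
    · rw [if_neg h0]

/-- **`IsSHolAt` at the `λ̄`-type corner `(y, NW)`**, at every site: the relation
`a₁ + d₁ = a₂ + d₂` between the north bond of `y` and its west bond is the real part of the CR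
identity of the bond's sheet at the cell `(-x, σ₀)`. [cite: ChelkakHonglerIzyurovAnnals2015, Lemma 2.14 and Remark 3.1] -/
theorem isSHolAt_slitFC_one (p₀ y : Site 2) : IsSHolAt (slitFC p₀) (y, 1) := by
  show projLine (cornerLine y (cFace (y, 1))) (slitFC p₀ (cSrc (y, 1))) = projLine (cornerLine y (cFace (y, 1))) (slitFC p₀ (cTgt (y, 1)))
  simp only [cFace, cSrc, cTgt, show (1 : Fin 4) + 1 = 2 from rfl, westBond_eq, slitFC_east, slitFC_north]
  rw [projLine_cornerLine_eq_iff 0 y 1 (n := 1) (by norm_num), slitFCH, slitFCV, re_frameCoord_kcVec0_one, re_frameCoord_kcVec0_one,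
    (srcDX_west p₀ y).1, (srcDX_west p₀ y).2]
  congr 1
  set κ := -srcDX p₀ y with hκ
  set σ := srcDY p₀ y with hσ
  rw [show σ + 1 - 1 = σ by ring, show -(srcDX p₀ y - 1) = κ + 1 by omega]
  exact (cr_re_parts (slitFsh_cr κ σ)).1

/-- **`IsSHolAt` at the `λ`-type corner `(y, SE)`**, at every site: the relation
`a₁ - d₁ = a₂ - d₂` between the south bond of `y` and its east bond is the real part of the CR
identity of the bond's sheet at the cell `(-x, σ₀ - 1)`. [cite: ChelkakHonglerIzyurovAnnals2015, Lemma 2.14 and Remark 3.1] -/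
theorem isSHolAt_slitFC_three (p₀ y : Site 2) : IsSHolAt (slitFC p₀) (y, 3) := by
  show projLine (cornerLine y (cFace (y, 3))) (slitFC p₀ (cSrc (y, 3))) = projLine (cornerLine y (cFace (y, 3))) (slitFC p₀ (cTgt (y, 3)))
  simp only [cFace, cSrc, cTgt, show (3 : Fin 4) + 1 = 0 from rfl, southBond_eq, slitFC_east, slitFC_north]
  rw [projLine_cornerLine_eq_iff 0 y 3 (n := 3) (by norm_num), slitFCH, slitFCV, re_frameCoord_kcVec0_three, re_frameCoord_kcVec0_three,
    (srcDX_south p₀ y).1, (srcDX_south p₀ y).2]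
  congr 1
  congr 1
  set κ := -srcDX p₀ y with hκ
  set σ := srcDY p₀ y with hσ
  rw [show σ - 1 + 1 = σ by ring, show -(srcDX p₀ y - 1) = κ + 1 by omega]
  have h := (cr_re_parts (slitFsh_cr κ (σ - 1))).2
  rw [show σ - 1 + 1 = σ by ring] at h
  exact h

/-- **`IsSHolAt` at the `i`-type corner `(y, SW)` off the cut**: the west and the south bond of `y`
both carry `d = Re(-i F(1 - x, σ₀))`, on the sheets `σ₀` and `σ₀ - 1`; these agree unless the
corner lies on the cut row west of the tip (`σ₀ = 0`, `1 - x ≤ -1`). [cite: ChelkakHonglerIzyurovAnnals2015, Lemma 2.14] -/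
theorem isSHolAt_slitFC_two (p₀ y : Site 2) (h : srcDY p₀ y ≠ 0 ∨ srcDX p₀ y ≤ 0) : IsSHolAt (slitFC p₀) (y, 2) := by
  show projLine (cornerLine y (cFace (y, 2))) (slitFC p₀ (cSrc (y, 2))) = projLine (cornerLine y (cFace (y, 2))) (slitFC p₀ (cTgt (y, 2)))
  simp only [cFace, cSrc, cTgt, show (2 : Fin 4) + 1 = 3 from rfl, westBond_eq, southBond_eq, slitFC_east, slitFC_north]
  rw [projLine_cornerLine_eq_iff 0 y 2 (n := 2) (by norm_num), slitFCH, slitFCV, re_frameCoord_kcVec0_two, re_frameCoord_kcVec0_two,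
    (srcDX_west p₀ y).1, (srcDX_west p₀ y).2, (srcDX_south p₀ y).1, (srcDX_south p₀ y).2]
  congr 1
  congr 1
  rw [show srcDY p₀ y + 1 - 1 = srcDY p₀ y by ring, show srcDY p₀ y - 1 + 1 = srcDY p₀ y by ring]
  congr 1
  congr 1
  -- the `d`-values at `(1 - x, σ₀)` on the sheets `σ₀` (west bond) and `σ₀ - 1` (south bond)
  unfold slitFsh
  by_cases h1 : 0 ≤ srcDY p₀ y - 1
  · rw [if_pos h1, if_pos (by omega)]
  · rw [if_neg h1]
    by_cases h0 : 0 ≤ srcDY p₀ y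
    · rw [if_pos h0]
      have hs : srcDY p₀ y = 0 := by omega
      have hk : 1 ≤ -(srcDX p₀ y - 1) := by
        rcases h with h | h
        · exact absurd hs h
        · omega
      rw [slitFup_eq_slitFdn (Or.inr (Or.inr hk))]
    · rw [if_neg h0]

/-- **The cut**: at the `i`-type corners `(y, SW)` on the cut row west of the tip
(`σ₀ = 0`; odd model abscissae `1 - x`) the index-`2` frame projections of the west and the south
bond are OPPOSITE — the sheet change of the spinor across `L_a` (`slitFup_row_eq_neg`); west of the
tip (`1 - x ≤ -1`, the source `-1` included) the value is nonzero and `slitFC` is not `IsSHolAt`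
there, east of it both sheets vanish at these corners (`R_a`) and the statement is `0 = -0`.
[cite: ChelkakHonglerIzyurovAnnals2015, §3.2 and Lemma 3.5] -/
theorem frameCoord_slitFC_two_cut (p₀ y : Site 2) (hs : srcDY p₀ y = 0) :
    (frameCoord 0 (slitFC p₀ (cSrc (y, 2))) * (1 + I) ^ 2).re = -(frameCoord 0 (slitFC p₀ (cTgt (y, 2))) * (1 + I) ^ 2).re := by
  simp only [cSrc, cTgt, show (2 : Fin 4) + 1 = 3 from rfl, westBond_eq, southBond_eq, slitFC_east, slitFC_north]
  rw [slitFCH, slitFCV, re_frameCoord_kcVec0_two, re_frameCoord_kcVec0_two, (srcDX_west p₀ y).1, (srcDX_west p₀ y).2,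
    (srcDX_south p₀ y).1, (srcDX_south p₀ y).2, hs]
  norm_num
  -- `Re(-i slitFup(κ,0)) = - Re(-i slitFdn(κ,0))` at the odd `κ = 1 - x ≤ -1`
  unfold slitFsh
  rw [if_pos le_rfl, if_neg (by norm_num)]
  have hodd : Odd (1 - srcDX p₀ y) := by
    have := neg_srcDX_add_srcDY p₀ y
    rw [hs, add_zero] at this
    exact ⟨-(y 0 - p₀ 0), by omega⟩
  rw [slitFup_row_eq_neg hodd, Complex.neg_im]
  ring

/-- **The values at the tip and at the source** (CHI: `F(a + 3δ/2) = 1`, and Lemma 3.5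
`P_{iℝ} F(a + (1±i)δ/2) = ∓ i`): the east bond of `p₀` (just below the tip corner `(p₀, NE)` and
the source corner `(p₀ + e₀, SW)` … ) carries `a = 1`, and the two bonds at the source corner
`(p₀ + e₀ + e₁, SW)` carry `d = ∓ 1`. [cite: ChelkakHonglerIzyurovAnnals2015, Lemma 2.14 and Lemma 3.5] -/
theorem slitFCH_source_a (p₀ : Site 2) : (frameCoord 0 (slitFCH p₀ p₀) * (1 + I) ^ 0).re = 1 * frameNorm 0 0 := by
  rw [slitFCH, re_frameCoord_kcVec_zero]
  congr 1
  simp only [srcDX, srcDY, sub_self, add_zero, neg_zero, zero_sub, slitFsh, show ¬ (0 : ℤ) ≤ -1 by norm_num, if_false]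
  rw [← slitFup_eq_slitFdn (Or.inr (Or.inl (⟨0, by norm_num⟩ : Even (0 : ℤ)))), slitFup_zero_zero, Complex.one_re]


/-- Coordinates of the source site `v₀ = p₀ + e₀ + e₁`: `x = 2`, `y = 0`. [folklore] -/
theorem srcDX_source (p₀ : Site 2) :
    srcDX p₀ (p₀ + cornerUnit 0 + cornerUnit 1) = 2 ∧ srcDY p₀ (p₀ + cornerUnit 0 + cornerUnit 1) = 0 := by
  simp [srcDX, srcDY, cornerUnit]

/-- **The source corner** `(v₀, SW)`, `v₀ = p₀ + e₀ + e₁` (CHI Lemma 3.5,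
`P_{iℝ} F_{[ℂ_δ,a]}(a + (1 ± i)δ/2) = ∓ i`, in the tree's frame): the index-`2` projections of the
west bond (sheet `Ξ_+`, value `slitFup(-1,0) = -i`) and of the south bond (sheet `Ξ_-`, value
`slitFdn(-1,0) = +i`) are `-2N₀` and `+2N₀`. [cite: ChelkakHonglerIzyurovAnnals2015, Lemma 3.5] -/
theorem frameCoord_slitFC_source (p₀ : Site 2) :
    (frameCoord 0 (slitFC p₀ (cSrc (p₀ + cornerUnit 0 + cornerUnit 1, 2))) * (1 + I) ^ 2).re = 2 * (-1) * frameNorm 0 0 ∧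
    (frameCoord 0 (slitFC p₀ (cTgt (p₀ + cornerUnit 0 + cornerUnit 1, 2))) * (1 + I) ^ 2).re = 2 * 1 * frameNorm 0 0 := by
  have hup : slitFup (-1) 0 = -I := slitFup_neg_one_zero
  have hdn : slitFdn (-1) 0 = I := by
    have h := slitFup_row_eq_neg (k := -1) ⟨-1, by norm_num⟩
    rw [hup] at h
    linear_combination h
  simp only [cSrc, cTgt, show (2 : Fin 4) + 1 = 3 from rfl, westBond_eq, southBond_eq, slitFC_east, slitFC_north]
  rw [slitFCH, slitFCV, re_frameCoord_kcVec0_two, re_frameCoord_kcVec0_two, (srcDX_west p₀ _).1, (srcDX_west p₀ _).2,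
    (srcDX_south p₀ _).1, (srcDX_south p₀ _).2, (srcDX_source p₀).1, (srcDX_source p₀).2]
  norm_num
  simp only [slitFsh, le_refl, if_true, show ¬(0 : ℤ) ≤ -1 by norm_num, if_false, hup, hdn, Complex.neg_im, Complex.I_im]
  norm_num

end Literature.Probability.LatticeModels
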